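import Summits.CriticalPhenomena.SAWScalingLimit.Theses.SAWDefectDecoherence
import Summits.CriticalPhenomena.SAWScalingLimit.Theses.SAWPhaseRetrieval
import Summits.CriticalPhenomena.SAWScalingLimit.Theses.SAWWindingAlias
import Summits.CriticalPhenomena.SAWScalingLimit.Theses.SAWDevelopingMap
import Summits.CriticalPhenomena.SAWScalingLimit.Theses.SAWTrackTransport
import Summits.CriticalPhenomena.SAWScalingLimit.Theses.SAWCompassLattice
import Summits.CriticalPhenomena.SAWScalingLimit.Theorems.SAWDevelopingMapHexTransferCompassEndpoints
import Summits.CriticalPhenomena.SAWScalingLimit.Theorems.SAWMassiveIsingTiltHexEndpointApproxExists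
import Literature.Probability.RandomPlanarGeometry.SLEUniquenessInLaw

/-!
# `HexTransfer` (crux stmt-CriticalPhenomena-14221) splits along the Yang–Baxter family:
# hexagonal ↔ square-tiling transport + the square-tiling → uniform `δℤ²` toll

Crux (route `SAWDefectDecoherence`, shared with five sibling routes):
`HexTransfer := HexSAWScalingLimit ("(A)", DCS 2012 Conj. 1 written out) → SAWScalingLimit`.

Glazman–Manolescu (arXiv:1708.00395, p. 4 and §4): the critical Yang–Baxter walk on the rhombic
tiling `H(π/3)` IS the regular self-avoiding walk on the (isotropic) hexagonal lattice, and the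
Yang–Baxter transformation "is used to gradually transform the lattice `H(π/3)` into an arbitrary
lattice `H(Θ)`" — the hexagonal lattice is the REFERENCE lattice of the only cross-model transport
that exists for the planar SAW. This file records, sorry-free, the decomposition of the crux along
that transport (strategist, wall-breaker seat `cstrat-stmt-CriticalPhenomena-14221-p1`):

* `YBHexUniversality` — CHILD 1 (new): the critical hexagonal SAW law (`hexSAWLaw`, the antecedent's
  own conventions) and the critical Glazman–Manolescu law on the SQUARE tiling
  (`ybLaw (Θ ≡ π/2)`, `x = 1`) are asymptotically equal on bounded continuous test functions, in
  every Dobrushin domain and for every pair of endpoint approximations — law-level transport INSIDE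
  the Yang–Baxter family, from its hexagonal end (`Θ ≡ π/3`) to its square end (`Θ ≡ π/2`); the
  `n = 0` analogue, with the hexagonal lattice as reference, of DKKMO's universality among isoradial
  lattices (arXiv:2012.11672, Thm 2.1) — route `SAWTrackTransport`'s engine `AngleUniversality`
  runs the same transport in the direction square → `α`.
* CHILD 2 = `SAWTrackTransport.YBtoUniform` (item stmt-CriticalPhenomena-16997, verbatim): the
  square-tiling Yang–Baxter law and the uniform critical `δℤ²` law `SAW.law` are asymptotically
  equal — the toll OUT of the family (uniform `ℤ²` SAW lies in no Yang–Baxter family, barrier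
  `NienhuisWeightsExcludeVertexSAW`).
* `ybSquareSLE_of_hex` — under (A), child 1 gives `SAWCompassLattice.YBSquareSLE` (item 6967):
  (A) is CONSUMED here (two-ε argument), it is not decorative — without (A) the two children identify
  no limit at all.
* `HexTransfer_of_subs : YBHexUniversality → YBtoUniform → HexTransfer` — the glue of the split
  (two-ε argument again, through the square-tiling walk), for all six route copies of the crux.

All endpoint approximations needed exist unconditionally: hexagonal ones by
`HexEndpointApprox.exists_isEmbEndpointApprox` (item 9864, landed), square-tiling ones by
`Sketch.stub_compassEndpoints` (= `SAWCompassLattice.CompassEndpoints`, landed p90649).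
-/

noncomputable section

namespace Summit.CriticalPhenomena.SAWScalingLimit.Cruxes.HexTransfer.YBRelay

open MeasureTheory Filter Topology
open Literature.Probability.LatticeModels Literature.Probability.RandomPlanarGeometry
open Literature.Probability.RandomPlanarGeometry.SAW
open Literature.Probability.RandomPlanarGeometry.SAW.YangBaxter
open Summit.CriticalPhenomena.SAWScalingLimit.Theses
open Summit.CriticalPhenomena.SAWScalingLimit.Theorems.HexEndpointApprox (exists_isEmbEndpointApprox)
open scoped NNReal ENNReal BoundedContinuousFunction

/-- **Child 1 of the split — `YBHexUniversality`** (law-level Yang–Baxter transport, hexagonal end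
→ square end of the Glazman–Manolescu family): for every Dobrushin domain `D`, every hexagonal
endpoint approximation `(a, b)` (`IsEmbEndpointApprox hexGraph hexCenter`, the conventions of the
antecedent `HexSAWScalingLimit`) and every square-tiling Yang–Baxter endpoint approximation
`(a', b')` (`IsYBEndpointApprox (Θ ≡ π/2)`), and every bounded continuous `f` on `CurveClass ℂ`,
`∫ f∘curve d hexSAWLaw(D)_δ − ∫ f∘(YBWalk.curve) d ybLaw(π/2)(D)_δ → 0` as `δ → 0⁺`.
[cite: GlazmanManolescu2019, p. 4 and §4 (the model on H(π/3) is the regular hexagonal SAW; the Yang–Baxter transformation transforms H(π/3) into H(Θ))]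
[cite: DKKMO2020Rotational, Theorem 2.1 (universality among isoradial rectangular lattices, the sibling mechanism)] -/
def YBHexUniversality : Prop :=
  ∀ (D : DobrushinDomain) (a b : ℝ → HexVertex) (a' b' : ℝ → MidEdge),
    SAW.IsEmbEndpointApprox hexGraph hexCenter D a b →
    IsYBEndpointApprox (fun (_ : ℤ) => Real.pi / 2) D a' b' →
    ∀ f : BoundedContinuousFunction (CurveClass ℂ) ℝ,
      Tendsto (fun δ : ℝ => (∫ γ, f γ.curve ∂(SAW.hexSAWLaw D.carrier δ (a δ) (b δ))) -
          ∫ γ, f (γ.curve (fun (_ : ℤ) => Real.pi / 2) δ)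
            ∂(ybLaw (fun (_ : ℤ) => Real.pi / 2) D.carrier δ 1 (a' δ) (b' δ)))
        (𝓝[>] (0 : ℝ)) (𝓝 0)

/-- **(A) is consumed by child 1**: DCS Conjecture 1 (hexagonal lattice) and `YBHexUniversality` give
`YBSquareSLE` (item stmt-CriticalPhenomena-6967: the critical square-tiling Yang–Baxter walk converges
to chordal SLE(8/3)). Two-ε argument: pick a hexagonal endpoint approximation of `D` (item 9864,
landed), take the SLE(8/3) random curve `Γ` (A) provides there, and subtract. [folklore] -/
theorem ybSquareSLE_of_hex (hA : HexSAWScalingLimit) (hU : YBHexUniversality) :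
    SAWCompassLattice.YBSquareSLE := by
  intro D a' b' hab'
  obtain ⟨a, b, hab⟩ := exists_isEmbEndpointApprox D
  obtain ⟨Γ, hΓ, -, hT⟩ := hA D a b hab
  refine ⟨Γ, hΓ, Eventually.of_forall fun δ => YBWalk.aemeasurable_curve _ D.carrier δ 1 (a' δ) (b' δ),
    fun f => ?_⟩
  have h := (hT f).sub (hU D a b a' b' hab hab' f)
  rw [sub_zero] at h
  exact h.congr fun δ => sub_sub_cancel _ _

/-- **The glue of the split**: `YBHexUniversality → YBtoUniform → HexTransfer` (route
`SAWDefectDecoherence`'s copy). Given (A) and a `δℤ²` endpoint approximation `(a, b)` of `D`, pick a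
square-tiling Yang–Baxter endpoint approximation `(a', b')` of `D` (landed `Sketch.stub_compassEndpoints`);
`ybSquareSLE_of_hex` gives an SLE(8/3) random curve `Γ` with `∫ f d ybLaw(π/2)_δ → E f(Γ)`; the toll
`YBtoUniform` gives `∫ f dP^{ℤ²}_δ − ∫ f d ybLaw(π/2)_δ → 0`; add. [folklore] -/
theorem HexTransfer_of_subs (hU : YBHexUniversality) (hT : SAWTrackTransport.YBtoUniform) :
    SAWDefectDecoherence.HexTransfer := by
  intro hA D a b hab
  obtain ⟨a', b', hab'⟩ := Sketch.stub_compassEndpoints D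
  obtain ⟨Γ, hΓ, -, hY⟩ := ybSquareSLE_of_hex hA hU D a' b' hab'
  refine ⟨Γ, hΓ, Eventually.of_forall fun δ => aemeasurable_curve D.carrier δ (a δ) (b δ), fun f => ?_⟩
  have h := (hT D a b a' b' hab hab' f).add (hY f)
  rw [zero_add] at h
  exact h.congr fun δ => sub_add_cancel _ _

/-- The same glue for the five sibling copies of the crux (identical bodies, `Iff.rfl`). [folklore] -/
theorem HexTransfer_of_subs_siblings (hU : YBHexUniversality) (hT : SAWTrackTransport.YBtoUniform) :
    SAWPhaseRetrieval.HexTransfer ∧ SAWWindingAlias.HexTransfer ∧ SAWDevelopingMap.HexTransfer :=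
  ⟨HexTransfer_of_subs hU hT, HexTransfer_of_subs hU hT, HexTransfer_of_subs hU hT⟩

/-- Conversely, where the crux has content the split loses nothing on the Yang–Baxter side: under (A),
`YBSquareSLE` gives back child 1 (both limits are chordal SLE(8/3) random curves of the same Dobrushin
domain, equal in law by `IsSLECurve.map_eq_holds`). So, given (A), child 1 is EQUIVALENT to item 6967 —
it is the transport statement of 6967 with the identification of the limit factored out. [folklore] -/
theorem ybHexUniversality_of_ybSquareSLE (hA : HexSAWScalingLimit) (hY : SAWCompassLattice.YBSquareSLE) :
    YBHexUniversality := by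
  intro D a b a' b' hab hab' f
  obtain ⟨Γ, hΓ, -, hT⟩ := hA D a b hab
  obtain ⟨Γ', hΓ', -, hT'⟩ := hY D a' b' hab'
  have hint : ∫ ω, f (Γ ω) ∂Literature.Probability.Process.preWienerMeasure = ∫ ω, f (Γ' ω) ∂Literature.Probability.Process.preWienerMeasure := by
    rw [← integral_map hΓ.1 f.continuous.aestronglyMeasurable,
      ← integral_map hΓ'.1 f.continuous.aestronglyMeasurable, IsSLECurve.map_eq_holds hΓ hΓ']
  have h := (hT f).sub (hT' f)
  rwa [hint, sub_self] at h

end Summit.CriticalPhenomena.SAWScalingLimit.Cruxes.HexTransfer.YBRelay
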